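import Literature.AlgebraicGeometry.Motives.AffineLineBundleDominant
import HarnessLib

/-!
# Reduced closed subschemes with the same support are isomorphic; transport of `Z_d ≤ Rat_d`

Two generic tools for computing Chow groups by stratification (Fulton, *Intersection Theory*,
§1.9, Examples 1.9.1, 1.9.3), used for `CH₁(ℙⁿ) = ℤ·[line]` (`Motives/ChowProjectiveSpaceLines`):

* `ker_eq_vanishingIdeal_of_isReduced` — the kernel (ideal sheaf) of a closed immersion
  `f : X ↪ Z` from a **reduced** scheme is the vanishing ideal sheaf of its image (Hartshorne II
  Example 3.2.6 / Stacks 01J3: the reduced induced closed subscheme structure);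
  `exists_iso_of_isClosedImmersion_of_range_eq` — hence two closed immersions `f : X ↪ Z`,
  `g : Y ↪ Z` from reduced schemes with the same image differ by a unique isomorphism `Y ≅ X`
  over `Z` (Mathlib's `IsClosedImmersion.lift` and `IsClosedImmersion.isIso_of_ker_eq`).
* `algebraicCycleComap_mem_ratTrivial_of_iso`, `cyclesOfDim_le_ratTrivial_of_iso` — rational
  equivalence to zero (`ratTrivial`, generated by the tree's genuine `[div_W r]`) is transported
  along isomorphisms of schemes, so "`Z_d(F) ≤ Rat_d(F)`" (i.e. `A_d(F) = 0`) is invariant under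
  `F ≅ G` (generator-wise this is `algebraicCycleComap_mem_ratEquivGenerators_of_iso` of
  `Motives/AffineLineBundleDominant`).

Everything is proved; no named facts.

## References

* R. Hartshorne, *Algebraic Geometry*, II Example 3.2.6 (reduced induced structure). [Hartshorne1977]
* W. Fulton, *Intersection Theory*, 2nd ed. (1998), §1.3, §1.9. [Fulton1998]
-/

noncomputable section

open CategoryTheory AlgebraicGeometry Order TopologicalSpace

universe u

namespace Literature.AlgebraicGeometry.Motives

/-! ### Closed immersions from reduced schemes -/

section Reduced

variable {X Y Z : Scheme.{u}}

/-- The kernel of a closed immersion from a reduced scheme is a radical ideal sheaf. [folklore] -/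
theorem radical_ker_of_isReduced (f : X ⟶ Z) [IsClosedImmersion f] [IsReduced X] :
    f.ker.radical = f.ker := by
  refine le_antisymm ?_ (Scheme.IdealSheafData.le_radical (I := f.ker))
  intro U
  rw [Scheme.IdealSheafData.radical_ideal, Scheme.Hom.ker_apply]
  intro x hx
  obtain ⟨n, hn⟩ := hx
  rw [RingHom.mem_ker] at hn ⊢
  rw [map_pow] at hn
  exact IsReduced.eq_zero _ ⟨n, hn⟩

/-- **Reduced induced structure.** The kernel of a closed immersion `f : X ↪ Z` from a reduced
scheme is the vanishing ideal sheaf of the closed set `f(X)`.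
[cite: Hartshorne1977, II Example 3.2.6] -/
theorem ker_eq_vanishingIdeal_of_isReduced (f : X ⟶ Z) [IsClosedImmersion f] [IsReduced X] :
    f.ker = Scheme.IdealSheafData.vanishingIdeal
      ⟨Set.range f.base, f.isClosedEmbedding.isClosed_range⟩ := by
  rw [← radical_ker_of_isReduced f, ← Scheme.IdealSheafData.vanishingIdeal_support]
  congr 1
  ext1
  rw [Scheme.Hom.support_ker, f.isClosedEmbedding.isClosed_range.closure_eq]
  rfl

/-- Two closed immersions from reduced schemes with the same image have the same kernel.
[cite: Hartshorne1977, II Example 3.2.6] -/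
theorem ker_eq_ker_of_range_eq (f : X ⟶ Z) (g : Y ⟶ Z) [IsClosedImmersion f]
    [IsClosedImmersion g] [IsReduced X] [IsReduced Y]
    (h : Set.range f.base = Set.range g.base) : f.ker = g.ker := by
  rw [ker_eq_vanishingIdeal_of_isReduced f, ker_eq_vanishingIdeal_of_isReduced g]
  congr 1
  ext1
  exact h

/-- **Uniqueness of the reduced closed subscheme structure**: two closed immersions
`f : X ↪ Z`, `g : Y ↪ Z` from reduced schemes with the same image differ by an isomorphism
`e : Y ≅ X` over `Z` (`e ≫ f = g`). [cite: Hartshorne1977, II Example 3.2.6] -/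
theorem exists_iso_of_isClosedImmersion_of_range_eq (f : X ⟶ Z) (g : Y ⟶ Z)
    [IsClosedImmersion f] [IsClosedImmersion g] [IsReduced X] [IsReduced Y]
    (h : Set.range f.base = Set.range g.base) : ∃ e : Y ≅ X, e.hom ≫ f = g := by
  have hker := ker_eq_ker_of_range_eq f g h
  haveI := IsClosedImmersion.isIso_of_ker_eq g f (IsClosedImmersion.lift f g hker.le)
    (IsClosedImmersion.lift_fac f g hker.le) hker.symm
  exact ⟨asIso (IsClosedImmersion.lift f g hker.le), IsClosedImmersion.lift_fac f g hker.le⟩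

end Reduced

/-! ### Transport of rational triviality along isomorphisms -/

section IsoTransport

variable {F G : Scheme.{u}}

/-- Restriction of cycles along an isomorphism maps `Rat_d(G)` into `Rat_d(F)`. [folklore] -/
theorem algebraicCycleComap_mem_ratTrivial_of_iso (e : F ≅ G) {d : ℕ} {c : AlgebraicCycle G ℤ}
    (hc : c ∈ ratTrivial G d) :
    algebraicCycleComap e.hom e.hom.isClosedEmbedding.injective c ∈ ratTrivial F d := by
  change algebraicCycleComapHom e.hom e.hom.isClosedEmbedding.injective c ∈ ratTrivial F d
  refine AddSubgroup.closure_induction (p := fun c _ ↦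
      algebraicCycleComapHom e.hom e.hom.isClosedEmbedding.injective c ∈ ratTrivial F d)
    (fun c hc ↦ ?_) (by rw [map_zero]; exact zero_mem _) (fun a b _ _ ha hb ↦ ?_)
    (fun a _ ha ↦ ?_) hc
  · exact AddSubgroup.subset_closure (algebraicCycleComap_mem_ratEquivGenerators_of_iso e hc)
  · rw [map_add]; exact add_mem ha hb
  · rw [map_neg]; exact neg_mem ha

/-- Restriction along `e.hom` after restriction along `e.inv` is the identity. [folklore] -/
theorem algebraicCycleComap_hom_comap_inv (e : F ≅ G) (c : AlgebraicCycle F ℤ) :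
    algebraicCycleComap e.hom e.hom.isClosedEmbedding.injective
      (algebraicCycleComap e.inv e.inv.isClosedEmbedding.injective c) = c := by
  ext x
  simp only [algebraicCycleComap_apply, ← Scheme.Hom.comp_apply, Iso.hom_inv_id]
  rfl

/-- **`A_d = 0` is invariant under isomorphism**: if every `d`-cycle of `G` is rationally
equivalent to zero and `F ≅ G`, the same holds for `F`. [folklore] -/
theorem cyclesOfDim_le_ratTrivial_of_iso (e : F ≅ G) {d : ℕ}
    (h : cyclesOfDim G d ≤ ratTrivial G d) : cyclesOfDim F d ≤ ratTrivial F d := by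
  intro c hc
  rw [← algebraicCycleComap_hom_comap_inv e c]
  exact algebraicCycleComap_mem_ratTrivial_of_iso e
    (h (algebraicCycleComap_mem_cyclesOfDim e.inv hc))

end IsoTransport

end Literature.AlgebraicGeometry.Motives
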